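/-
Copyright: the b2b-balaban T⁴-continuum CRUX team, row NE7b OWNER lineage `t4-ne7b-p1` (gen 141). Project licence.
-/
import Summits.QuantumFields.BalabanUV.T4Continuum.Spine.NE7b.SupWhitenedHessianObservableMoments
import Summits.QuantumFields.BalabanUV.T4Continuum.Spine.NE7b.SupWhitenedThirdCumulantRaw
import Summits.QuantumFields.BalabanUV.T4Continuum.Spine.NE7b.SupWhitenedHessianGradientCovariance

/-!
# THE MIXED THIRD CUMULANT `κ₃(U″e_xe_y, U′e_z, U′e_t)` UNDER `N(0,AAᵀ)`, DISTINGUISHED FORMS (SCOPING (d13)(2): the three-point pieces of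
# `∂⁴W`, first file — (461) instantiated with ONE Hessian-entry vertex).  The observables `G_{xy} = U″(Aξ+ψ)[e_x,e_y]` (vector
# `g^{xy}_w = Σ_u|A_{uw}|K3_{xyu}`, fourth-moment letter `5κ₃⁴γ_op²∕(1−λγ_op)²` by (506)) and `F_v = U′(Aξ+ψ)[e_v]` (vectors `b^v`, letter
# `5κ₂⁴γ_op²∕(1−λγ_op)²` by (465)) under the common letter `M = 5(κ₂⁴+κ₃⁴)γ_op²∕(1−λγ_op)²`, Dobrushin's smallness and ANY admissible `D`:
#   `|E_ν(G_{xy} − EG_{xy})(F_z − EF_z)(F_t − EF_t)| ≤ 2√(2·(B(g^{xy},b^z) + B(g^{xy},b^t))·M)`   (Hessian vertex distinguished),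
#   `|E_ν(F_z − EF_z)(G_{xy} − EG_{xy})(F_t − EF_t)| ≤ 2√(2·(B(b^z,g^{xy}) + B(b^z,b^t))·M)`     (a gradient vertex distinguished),
# `B(a,b) = Σ_w (Dᵀa)_w(Dᵀb)_w∕(1−lamA)` — exactly as (467) did for three gradient components; with (466)'s decay and (463)'s tree lemma the
# mixed entry follows (successor) (row NE7b, node U5c; (461) `third_cumulant_le`, (465), (467), (469), (506) BY NAME; [folklore])

Cell `pub-balaban`, sub-cell `t4`, spine estimate NE7b (`T4WeightBudget.RelWeightBound`; the cell's OWN estimate — NOT PRINTED in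
[Bałaban 1983–89], NOT PROVED).  Crux-route work under `Spine/NE7b/` by the row OWNER (`t4-ne7b-p1` gen 141, file (507)) under FREEZE
(0)'s crux-prover clause; NOTHING of Bałaban's is named as a Lean object, valued or asserted; no `T4Continuum/Support` leaf typed; no
`def`, no notation (everything WRITTEN OUT); zero `sorry`.  Imports (BY NAME): the OWNER's (506) `…SupWhitenedHessianObservableMoments`
(`whitened_hessian_obs_fourth_moment_gibbs`, `whitened_hessian_obs_fourth_power_integrable`), (467) `…SupWhitenedThirdCumulantRaw` (for
(465) `whitened_fourth_moment_gibbs`, `whitened_fourth_power_integrable`, (461) `third_cumulant_le`, (458), (457), (456)), (469)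
`…SupWhitenedHessianGradientCovariance` (`hessian_obs_lipVec`).

WHAT IS PROVED ([folklore]): **`whitened_mixed_third_cumulant_hess_raw`**, **`whitened_mixed_third_cumulant_grad_raw`** (the displays).

HONEST (what this is NOT).  Distinguished forms only (the `t`-distinguished form is the second with `z, t` permuted and the integrand
commuted); (466)'s decay for the Hessian vector needs its weighted profile (a letter), then (463)'s tree step gives the mixed entry and the
row letter — successor files; the cumulant FORM of `∂⁴W` is NOT typed.  Scalar skeleton ((A3), NC-NE7b-α UNRULED); nothing of Bałaban's
asserted.  BY-NAME EFFECT ON THE WALL: NONE.  NE7b NOT PRINTED ∕ NOT PROVED; spine PROVED 0∕9; rung (B)+1 — the programme's measures remain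
FINITE-torus statements; NOT the mass gap, NOT Clay.  HONEST DEPENDENCY: continuum YM on T⁴ ⇐ BetaPertH ∧ nine spine estimates (0∕9
proved); BetaPertH ⇐ (D1) ∧ (D4) ∧ CAP+tail; G-an2-4 gates asym, D1 and NE2∕3∕4.
-/

set_option autoImplicit false
set_option maxSynthPendingDepth 2

noncomputable section

namespace Summit.QuantumFields.BalabanUV.T4Continuum.NE7b.SupWhitenedMixedThirdCumulantRaw

open MeasureTheory ProbabilityTheory Real Set Function Finset Matrix
open scoped BigOperators
open Literature.Probability.Distributions (matrixCLM)
open SupWhitenedFourthMoment (whitened_fourth_moment_gibbs whitened_fourth_power_integrable)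
open SupWhitenedHessianObservableMoments (whitened_hessian_obs_fourth_moment_gibbs whitened_hessian_obs_fourth_power_integrable)
open SupWhitenedMomentLetters (op_letter_nonneg whitened_exp_integrable whitened_second_moment_integrable)
open SupWhitenedCovarianceKernelLetter (whitenedV_hasDerivAt whitenedV_floor whitenedV_ceiling whitenedV_cross whitenedV_continuous
  whitened_integrable_lebesgue)
open SupWhitenedFirstOrderLetters (whitened_obs_lipVec whitened_cross_nonneg)
open SupWhitenedHessianGradientCovariance (hessian_obs_lipVec)
open SupDobrushinThirdCumulant (third_cumulant_le)
open SupEffectiveActionDerivative (mul_opBound_le_of_le)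

variable {ι κ : Type} [Fintype ι] [DecidableEq ι] [Fintype κ] [DecidableEq κ]

variable {U : EuclideanSpace ℝ ι → ℝ} {U' : EuclideanSpace ℝ ι → EuclideanSpace ℝ ι →L[ℝ] ℝ}
  {U'' : EuclideanSpace ℝ ι → EuclideanSpace ℝ ι →L[ℝ] EuclideanSpace ℝ ι →L[ℝ] ℝ}
  {U₃ : EuclideanSpace ℝ ι → EuclideanSpace ℝ ι →L[ℝ] EuclideanSpace ℝ ι →L[ℝ] EuclideanSpace ℝ ι →L[ℝ] ℝ} {Hk : ι → ι → ℝ} {K3 : ι → ι → ι → ℝ}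
  {A : Matrix ι κ ℝ} {γop κ₀ κ₁ κ₂ κ₃ a τ δ θ lam lamA γ : ℝ} {D : κ → κ → ℝ}

/-! ## §1. The Hessian vertex distinguished -/

/-- **THE MIXED THIRD CUMULANT, HESSIAN VERTEX DISTINGUISHED**:
`|∫(G_{xy} − EG_{xy})(F_z − EF_z)(F_t − EF_t)dν| ≤ 2√(2·(B(g^{xy},b^z) + B(g^{xy},b^t))·M)`, `M = 5(κ₂⁴+κ₃⁴)γ_op²∕(1−λγ_op)²`. [folklore] -/
theorem whitened_mixed_third_cumulant_hess_raw [Nonempty κ] (hΓop : (γop • (1 : Matrix ι ι ℝ) - A * Aᵀ).PosSemidef) (Y : Finset ι)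
    (hUd : ∀ φ : EuclideanSpace ℝ ι, HasFDerivAt U (U' φ) φ) (hU'd : ∀ φ : EuclideanSpace ℝ ι, HasFDerivAt U' (U'' φ) φ)
    (hU''d : ∀ φ : EuclideanSpace ℝ ι, HasFDerivAt U'' (U₃ φ) φ) (hU₃c : Continuous U₃) (hκ₀ : 0 ≤ κ₀) (hκ₁ : 0 ≤ κ₁) (ha : 0 ≤ a) (hτ : 0 < τ)
    (hδ : 0 < δ) (hθ0 : 0 < θ) (hθ1 : θ < 1) (hκθ : (2 * κ₀ * (1 + τ) + 4 * δ) * γop ≤ θ) (hκθw : 2 * κ₀ * (1 + τ) * γop + 4 * δ ≤ θ)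
    (hstab : ∀ φ : EuclideanSpace ℝ ι, -(κ₀ * ∑ x ∈ Y, φ x ^ 2) ≤ U φ)
    (hU'b : ∀ φ : EuclideanSpace ℝ ι, ‖U' φ‖ ≤ κ₁ * (a + ∑ x ∈ Y, φ x ^ 2)) (hU''b : ∀ φ : EuclideanSpace ℝ ι, ‖U'' φ‖ ≤ κ₂)
    (hU₃b : ∀ φ : EuclideanSpace ℝ ι, ‖U₃ φ‖ ≤ κ₃) (hlam : 0 ≤ lam)
    (hUsec : ∀ s : ℝ, 0 ≤ s → s ≤ 1 → ∀ a b : EuclideanSpace ℝ ι,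
      U ((1 - s) • a + s • b) - lam / 2 * (s * (1 - s)) * ∑ i, (a i - b i) ^ 2 ≤ (1 - s) * U a + s * U b)
    (hρ : lam * γop < 1)
    (hHk : ∀ (φ : EuclideanSpace ℝ ι) (x z : ι), |U'' φ (EuclideanSpace.single z (1 : ℝ)) (EuclideanSpace.single x (1 : ℝ))| ≤ Hk x z)
    (hHk0 : ∀ v u, 0 ≤ Hk v u)
    (hK3 : ∀ (φ : EuclideanSpace ℝ ι) (u x y : ι),
      |U₃ φ (EuclideanSpace.single u (1 : ℝ)) (EuclideanSpace.single x (1 : ℝ)) (EuclideanSpace.single y (1 : ℝ))| ≤ K3 x y u)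
    (ψ : EuclideanSpace ℝ ι) (hlamA : ∀ x : κ, ∑ u, ∑ v, |A u x| * |A v x| * Hk v u ≤ lamA) (hlamA1 : lamA < 1)
    (hrow : ∀ x : κ, ∑ w, (if w = x then 0 else ∑ u, ∑ v, |A u w| * |A v x| * Hk v u) / (1 - lamA) ≤ γ) (hγ0 : 0 ≤ γ) (hγ1 : γ < 1)
    (hD : ∀ x y, 0 ≤ D x y)
    (hDC : ∀ x y, (if x = y then (1 : ℝ) else 0) + ∑ z, D x z * ((if y = z then 0 else ∑ u, ∑ v, |A u y| * |A v z| * Hk v u) / (1 - lamA)) ≤ D x y)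
    (x y z t : ι) :
    |∫ w, (U'' (matrixCLM A (WithLp.toLp 2 w) + ψ) (EuclideanSpace.single x (1 : ℝ)) (EuclideanSpace.single y (1 : ℝ)) -
            ∫ w', U'' (matrixCLM A (WithLp.toLp 2 w') + ψ) (EuclideanSpace.single x (1 : ℝ)) (EuclideanSpace.single y (1 : ℝ))
              ∂((volume : Measure (κ → ℝ)).tilted fun z => -(1 / 2 * (z ⬝ᵥ z) + U (matrixCLM A (WithLp.toLp 2 z) + ψ)))) *
          (U' (matrixCLM A (WithLp.toLp 2 w) + ψ) (EuclideanSpace.single z (1 : ℝ)) -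
            ∫ w', U' (matrixCLM A (WithLp.toLp 2 w') + ψ) (EuclideanSpace.single z (1 : ℝ))
              ∂((volume : Measure (κ → ℝ)).tilted fun z => -(1 / 2 * (z ⬝ᵥ z) + U (matrixCLM A (WithLp.toLp 2 z) + ψ)))) *
          (U' (matrixCLM A (WithLp.toLp 2 w) + ψ) (EuclideanSpace.single t (1 : ℝ)) -
            ∫ w', U' (matrixCLM A (WithLp.toLp 2 w') + ψ) (EuclideanSpace.single t (1 : ℝ))
              ∂((volume : Measure (κ → ℝ)).tilted fun z => -(1 / 2 * (z ⬝ᵥ z) + U (matrixCLM A (WithLp.toLp 2 z) + ψ))))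
        ∂((volume : Measure (κ → ℝ)).tilted fun z => -(1 / 2 * (z ⬝ᵥ z) + U (matrixCLM A (WithLp.toLp 2 z) + ψ)))| ≤
      2 * Real.sqrt (2 * (∑ w, (∑ z', D z' w * ∑ u, |A u z'| * K3 x y u) * ((∑ z', D z' w * ∑ u, |A u z'| * Hk z u) +
        (∑ z', D z' w * ∑ u, |A u z'| * Hk t u)) / (1 - lamA)) * (5 * ((κ₂ ^ 4 + κ₃ ^ 4) * γop ^ 2) / (1 - lam * γop) ^ 2)) := by
  haveI : Nonempty ι := ⟨x⟩
  have hUc : Continuous U := continuous_iff_continuousAt.2 fun φ => (hUd φ).continuousAt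
  have hU''c : Continuous U'' := continuous_iff_continuousAt.2 fun φ => (hU''d φ).continuousAt
  have hcpos : ∀ _x : κ, 0 < 1 - lamA := fun _ => by linarith
  have hκθ₀ : 2 * κ₀ * (1 + τ) * γop ≤ θ := mul_opBound_le_of_le (by positivity) (by linarith) hθ0.le hκθ
  have hγop := op_letter_nonneg hΓop
  have hρ0 : 0 < 1 - lam * γop := sub_pos.2 hρ
  -- the moment letters of (447) in Lebesgue form ((458) through (457)'s bridge)
  have hI0 := whitened_exp_integrable hΓop Y hUc.measurable hκ₀ hτ hθ1 hκθ₀ hstab ψ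
  have hI2 := fun w => whitened_second_moment_integrable hΓop Y hUc.measurable hκ₀ hτ hδ hθ1 hκθw hstab ψ w
  have hV0 : Integrable (fun z : κ → ℝ => exp (-(1 / 2 * (z ⬝ᵥ z) + U (matrixCLM A (WithLp.toLp 2 z) + ψ)))) := by
    have h := whitened_integrable_lebesgue A ψ (k := fun _ => (1 : ℝ)) (by simpa only [mul_one] using hI0)
    simpa only [one_mul] using h
  have hV2 : ∀ w, Integrable (fun z : κ → ℝ => z w ^ 2 * exp (-(1 / 2 * (z ⬝ᵥ z) + U (matrixCLM A (WithLp.toLp 2 z) + ψ)))) := fun w => by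
    have h := whitened_integrable_lebesgue A ψ (k := fun ξ : EuclideanSpace ℝ κ => ξ w ^ 2) (hI2 w)
    simpa only [PiLp.toLp_apply] using h
  have hJ : ∀ x w : κ, 0 ≤ (if w = x then (0 : ℝ) else ∑ u, ∑ v, |A u w| * |A v x| * Hk v u) := fun x w => by
    split_ifs
    · exact le_rfl
    · exact whitened_cross_nonneg hHk0 A x w
  have hrow' : ∀ x : κ, ∑ w, (if w = x then (0 : ℝ) else ∑ u, ∑ v, |A u w| * |A v x| * Hk v u) / (1 - lamA) ≤ γ := hrow
  -- the fourth centred moments: gradient components ((465)) and the Hessian entry ((506)), under the common letter `M`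
  have hM1 : 5 * (κ₂ ^ 4 * γop ^ 2) / (1 - lam * γop) ^ 2 ≤ (5 * ((κ₂ ^ 4 + κ₃ ^ 4) * γop ^ 2) / (1 - lam * γop) ^ 2) :=
    div_le_div_of_nonneg_right (by nlinarith [pow_nonneg hγop 2, pow_nonneg ((norm_nonneg (U₃ ψ)).trans (hU₃b ψ)) 4]) (pow_pos hρ0 2).le
  have hM2 : 5 * (κ₃ ^ 4 * γop ^ 2) / (1 - lam * γop) ^ 2 ≤ (5 * ((κ₂ ^ 4 + κ₃ ^ 4) * γop ^ 2) / (1 - lam * γop) ^ 2) :=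
    div_le_div_of_nonneg_right (by nlinarith [pow_nonneg hγop 2, pow_nonneg ((norm_nonneg (U'' ψ)).trans (hU''b ψ)) 4]) (pow_pos hρ0 2).le
  have h4 := fun v => (whitened_fourth_moment_gibbs hΓop Y hUd hU'd hU''c hκ₀ hκ₁ ha hτ hδ hθ0 hθ1 hκθ hstab hU'b hU''b hlam hUsec hρ ψ v).trans hM1
  have hI4 := fun v c => whitened_fourth_power_integrable hΓop Y hUd hU'd hκ₀ hκ₁ ha hτ hδ hθ0 hθ1 hκθ hstab hU'b ψ v c
  have hG4 := (whitened_hessian_obs_fourth_moment_gibbs hΓop Y hUd hU''d hU₃c hκ₀ hτ hθ1 hκθ₀ hstab hU''b hU₃b hlam hUsec hρ ψ x y).trans hM2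
  have hIG4 := fun c => whitened_hessian_obs_fourth_power_integrable hΓop Y hUd hU''d hκ₀ hτ hθ1 hκθ₀ hstab hU''b ψ x y c
  -- (461) with everything written out
  exact third_cumulant_le
    (P := fun x F ω => (∫ s, F (update ω x s) * exp (-(1 / 2 * (update ω x s ⬝ᵥ update ω x s) + U (matrixCLM A (WithLp.toLp 2 (update ω x s)) + ψ))))
        /
      ∫ s, exp (-(1 / 2 * (update ω x s ⬝ᵥ update ω x s) + U (matrixCLM A (WithLp.toLp 2 (update ω x s)) + ψ))))
    (V := fun z => 1 / 2 * (z ⬝ᵥ z) + U (matrixCLM A (WithLp.toLp 2 z) + ψ))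
    (V₁ := fun x z => z x + U' (matrixCLM A (WithLp.toLp 2 z) + ψ) (matrixCLM A (EuclideanSpace.single x (1 : ℝ))))
    (c := fun _ => 1 - lamA) (Cw := 1 + lamA) (J := fun x w => if w = x then 0 else ∑ u, ∑ v, |A u w| * |A v x| * Hk v u) (γ := γ) (D := D)
    (F := fun w => U'' (matrixCLM A (WithLp.toLp 2 w) + ψ) (EuclideanSpace.single x (1 : ℝ)) (EuclideanSpace.single y (1 : ℝ)))
    (G := fun w => U' (matrixCLM A (WithLp.toLp 2 w) + ψ) (EuclideanSpace.single z (1 : ℝ)))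
    (H := fun w => U' (matrixCLM A (WithLp.toLp 2 w) + ψ) (EuclideanSpace.single t (1 : ℝ)))
    (a := fun w => ∑ u, |A u w| * K3 x y u) (b := fun w => ∑ u, |A u w| * Hk z u) (h := fun w => ∑ u, |A u w| * Hk t u)
    (fun _ _ _ => rfl) (fun x z => whitenedV_hasDerivAt hUd A ψ x z) (fun x z s t => whitenedV_floor hU'd hHk A hlamA ψ x z s t) hcpos
    (fun x z s t => whitenedV_ceiling hU'd hHk A hlamA ψ x z s t)
    (fun x w hw z s t => by rw [if_neg hw]; exact whitenedV_cross hU'd hHk A ψ x w hw z s t)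
    (whitenedV_continuous hUd A ψ) hV0 hV2 hJ (fun x => by simp) hrow' hγ0 hγ1 hD hDC
    (fun w z' s₁ s₂ => hessian_obs_lipVec hU''d hK3 A ψ x y w z' s₁ s₂)
    (fun w z' s₁ s₂ => whitened_obs_lipVec hU'd hHk A ψ z w z' s₁ s₂)
    (fun w z' s₁ s₂ => whitened_obs_lipVec hU'd hHk A ψ t w z' s₁ s₂) _ _ (hIG4 _) (hI4 z _) (hI4 t _) hG4 (h4 z) (h4 t)


/-! ## §2. A gradient vertex distinguished -/

/-- **THE MIXED THIRD CUMULANT, A GRADIENT VERTEX DISTINGUISHED**: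
`|∫(F_z − EF_z)(G_{xy} − EG_{xy})(F_t − EF_t)dν| ≤ 2√(2·(B(b^z,g^{xy}) + B(b^z,b^t))·M)`. [folklore] -/
theorem whitened_mixed_third_cumulant_grad_raw [Nonempty κ] (hΓop : (γop • (1 : Matrix ι ι ℝ) - A * Aᵀ).PosSemidef) (Y : Finset ι)
    (hUd : ∀ φ : EuclideanSpace ℝ ι, HasFDerivAt U (U' φ) φ) (hU'd : ∀ φ : EuclideanSpace ℝ ι, HasFDerivAt U' (U'' φ) φ)
    (hU''d : ∀ φ : EuclideanSpace ℝ ι, HasFDerivAt U'' (U₃ φ) φ) (hU₃c : Continuous U₃) (hκ₀ : 0 ≤ κ₀) (hκ₁ : 0 ≤ κ₁) (ha : 0 ≤ a) (hτ : 0 < τ)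
    (hδ : 0 < δ) (hθ0 : 0 < θ) (hθ1 : θ < 1) (hκθ : (2 * κ₀ * (1 + τ) + 4 * δ) * γop ≤ θ) (hκθw : 2 * κ₀ * (1 + τ) * γop + 4 * δ ≤ θ)
    (hstab : ∀ φ : EuclideanSpace ℝ ι, -(κ₀ * ∑ x ∈ Y, φ x ^ 2) ≤ U φ)
    (hU'b : ∀ φ : EuclideanSpace ℝ ι, ‖U' φ‖ ≤ κ₁ * (a + ∑ x ∈ Y, φ x ^ 2)) (hU''b : ∀ φ : EuclideanSpace ℝ ι, ‖U'' φ‖ ≤ κ₂)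
    (hU₃b : ∀ φ : EuclideanSpace ℝ ι, ‖U₃ φ‖ ≤ κ₃) (hlam : 0 ≤ lam)
    (hUsec : ∀ s : ℝ, 0 ≤ s → s ≤ 1 → ∀ a b : EuclideanSpace ℝ ι,
      U ((1 - s) • a + s • b) - lam / 2 * (s * (1 - s)) * ∑ i, (a i - b i) ^ 2 ≤ (1 - s) * U a + s * U b)
    (hρ : lam * γop < 1)
    (hHk : ∀ (φ : EuclideanSpace ℝ ι) (x z : ι), |U'' φ (EuclideanSpace.single z (1 : ℝ)) (EuclideanSpace.single x (1 : ℝ))| ≤ Hk x z)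
    (hHk0 : ∀ v u, 0 ≤ Hk v u)
    (hK3 : ∀ (φ : EuclideanSpace ℝ ι) (u x y : ι),
      |U₃ φ (EuclideanSpace.single u (1 : ℝ)) (EuclideanSpace.single x (1 : ℝ)) (EuclideanSpace.single y (1 : ℝ))| ≤ K3 x y u)
    (ψ : EuclideanSpace ℝ ι) (hlamA : ∀ x : κ, ∑ u, ∑ v, |A u x| * |A v x| * Hk v u ≤ lamA) (hlamA1 : lamA < 1)
    (hrow : ∀ x : κ, ∑ w, (if w = x then 0 else ∑ u, ∑ v, |A u w| * |A v x| * Hk v u) / (1 - lamA) ≤ γ) (hγ0 : 0 ≤ γ) (hγ1 : γ < 1)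
    (hD : ∀ x y, 0 ≤ D x y)
    (hDC : ∀ x y, (if x = y then (1 : ℝ) else 0) + ∑ z, D x z * ((if y = z then 0 else ∑ u, ∑ v, |A u y| * |A v z| * Hk v u) / (1 - lamA)) ≤ D x y)
    (x y z t : ι) :
    |∫ w, (U' (matrixCLM A (WithLp.toLp 2 w) + ψ) (EuclideanSpace.single z (1 : ℝ)) -
            ∫ w', U' (matrixCLM A (WithLp.toLp 2 w') + ψ) (EuclideanSpace.single z (1 : ℝ))
              ∂((volume : Measure (κ → ℝ)).tilted fun z => -(1 / 2 * (z ⬝ᵥ z) + U (matrixCLM A (WithLp.toLp 2 z) + ψ)))) *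
          (U'' (matrixCLM A (WithLp.toLp 2 w) + ψ) (EuclideanSpace.single x (1 : ℝ)) (EuclideanSpace.single y (1 : ℝ)) -
            ∫ w', U'' (matrixCLM A (WithLp.toLp 2 w') + ψ) (EuclideanSpace.single x (1 : ℝ)) (EuclideanSpace.single y (1 : ℝ))
              ∂((volume : Measure (κ → ℝ)).tilted fun z => -(1 / 2 * (z ⬝ᵥ z) + U (matrixCLM A (WithLp.toLp 2 z) + ψ)))) *
          (U' (matrixCLM A (WithLp.toLp 2 w) + ψ) (EuclideanSpace.single t (1 : ℝ)) -
            ∫ w', U' (matrixCLM A (WithLp.toLp 2 w') + ψ) (EuclideanSpace.single t (1 : ℝ))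
              ∂((volume : Measure (κ → ℝ)).tilted fun z => -(1 / 2 * (z ⬝ᵥ z) + U (matrixCLM A (WithLp.toLp 2 z) + ψ))))
        ∂((volume : Measure (κ → ℝ)).tilted fun z => -(1 / 2 * (z ⬝ᵥ z) + U (matrixCLM A (WithLp.toLp 2 z) + ψ)))| ≤
      2 * Real.sqrt (2 * (∑ w, (∑ z', D z' w * ∑ u, |A u z'| * Hk z u) * ((∑ z', D z' w * ∑ u, |A u z'| * K3 x y u) +
        (∑ z', D z' w * ∑ u, |A u z'| * Hk t u)) / (1 - lamA)) * (5 * ((κ₂ ^ 4 + κ₃ ^ 4) * γop ^ 2) / (1 - lam * γop) ^ 2)) := by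
  haveI : Nonempty ι := ⟨x⟩
  have hUc : Continuous U := continuous_iff_continuousAt.2 fun φ => (hUd φ).continuousAt
  have hU''c : Continuous U'' := continuous_iff_continuousAt.2 fun φ => (hU''d φ).continuousAt
  have hcpos : ∀ _x : κ, 0 < 1 - lamA := fun _ => by linarith
  have hκθ₀ : 2 * κ₀ * (1 + τ) * γop ≤ θ := mul_opBound_le_of_le (by positivity) (by linarith) hθ0.le hκθ
  have hγop := op_letter_nonneg hΓop
  have hρ0 : 0 < 1 - lam * γop := sub_pos.2 hρ
  -- the moment letters of (447) in Lebesgue form ((458) through (457)'s bridge)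
  have hI0 := whitened_exp_integrable hΓop Y hUc.measurable hκ₀ hτ hθ1 hκθ₀ hstab ψ
  have hI2 := fun w => whitened_second_moment_integrable hΓop Y hUc.measurable hκ₀ hτ hδ hθ1 hκθw hstab ψ w
  have hV0 : Integrable (fun z : κ → ℝ => exp (-(1 / 2 * (z ⬝ᵥ z) + U (matrixCLM A (WithLp.toLp 2 z) + ψ)))) := by
    have h := whitened_integrable_lebesgue A ψ (k := fun _ => (1 : ℝ)) (by simpa only [mul_one] using hI0)
    simpa only [one_mul] using h
  have hV2 : ∀ w, Integrable (fun z : κ → ℝ => z w ^ 2 * exp (-(1 / 2 * (z ⬝ᵥ z) + U (matrixCLM A (WithLp.toLp 2 z) + ψ)))) := fun w => by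
    have h := whitened_integrable_lebesgue A ψ (k := fun ξ : EuclideanSpace ℝ κ => ξ w ^ 2) (hI2 w)
    simpa only [PiLp.toLp_apply] using h
  have hJ : ∀ x w : κ, 0 ≤ (if w = x then (0 : ℝ) else ∑ u, ∑ v, |A u w| * |A v x| * Hk v u) := fun x w => by
    split_ifs
    · exact le_rfl
    · exact whitened_cross_nonneg hHk0 A x w
  have hrow' : ∀ x : κ, ∑ w, (if w = x then (0 : ℝ) else ∑ u, ∑ v, |A u w| * |A v x| * Hk v u) / (1 - lamA) ≤ γ := hrow
  -- the fourth centred moments: gradient components ((465)) and the Hessian entry ((506)), under the common letter `M`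
  have hM1 : 5 * (κ₂ ^ 4 * γop ^ 2) / (1 - lam * γop) ^ 2 ≤ (5 * ((κ₂ ^ 4 + κ₃ ^ 4) * γop ^ 2) / (1 - lam * γop) ^ 2) :=
    div_le_div_of_nonneg_right (by nlinarith [pow_nonneg hγop 2, pow_nonneg ((norm_nonneg (U₃ ψ)).trans (hU₃b ψ)) 4]) (pow_pos hρ0 2).le
  have hM2 : 5 * (κ₃ ^ 4 * γop ^ 2) / (1 - lam * γop) ^ 2 ≤ (5 * ((κ₂ ^ 4 + κ₃ ^ 4) * γop ^ 2) / (1 - lam * γop) ^ 2) :=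
    div_le_div_of_nonneg_right (by nlinarith [pow_nonneg hγop 2, pow_nonneg ((norm_nonneg (U'' ψ)).trans (hU''b ψ)) 4]) (pow_pos hρ0 2).le
  have h4 := fun v => (whitened_fourth_moment_gibbs hΓop Y hUd hU'd hU''c hκ₀ hκ₁ ha hτ hδ hθ0 hθ1 hκθ hstab hU'b hU''b hlam hUsec hρ ψ v).trans hM1
  have hI4 := fun v c => whitened_fourth_power_integrable hΓop Y hUd hU'd hκ₀ hκ₁ ha hτ hδ hθ0 hθ1 hκθ hstab hU'b ψ v c
  have hG4 := (whitened_hessian_obs_fourth_moment_gibbs hΓop Y hUd hU''d hU₃c hκ₀ hτ hθ1 hκθ₀ hstab hU''b hU₃b hlam hUsec hρ ψ x y).trans hM2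
  have hIG4 := fun c => whitened_hessian_obs_fourth_power_integrable hΓop Y hUd hU''d hκ₀ hτ hθ1 hκθ₀ hstab hU''b ψ x y c
  -- (461) with everything written out
  exact third_cumulant_le
    (P := fun x F ω => (∫ s, F (update ω x s) * exp (-(1 / 2 * (update ω x s ⬝ᵥ update ω x s) + U (matrixCLM A (WithLp.toLp 2 (update ω x s)) + ψ))))
        /
      ∫ s, exp (-(1 / 2 * (update ω x s ⬝ᵥ update ω x s) + U (matrixCLM A (WithLp.toLp 2 (update ω x s)) + ψ))))
    (V := fun z => 1 / 2 * (z ⬝ᵥ z) + U (matrixCLM A (WithLp.toLp 2 z) + ψ))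
    (V₁ := fun x z => z x + U' (matrixCLM A (WithLp.toLp 2 z) + ψ) (matrixCLM A (EuclideanSpace.single x (1 : ℝ))))
    (c := fun _ => 1 - lamA) (Cw := 1 + lamA) (J := fun x w => if w = x then 0 else ∑ u, ∑ v, |A u w| * |A v x| * Hk v u) (γ := γ) (D := D)
    (F := fun w => U' (matrixCLM A (WithLp.toLp 2 w) + ψ) (EuclideanSpace.single z (1 : ℝ)))
    (G := fun w => U'' (matrixCLM A (WithLp.toLp 2 w) + ψ) (EuclideanSpace.single x (1 : ℝ)) (EuclideanSpace.single y (1 : ℝ)))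
    (H := fun w => U' (matrixCLM A (WithLp.toLp 2 w) + ψ) (EuclideanSpace.single t (1 : ℝ)))
    (a := fun w => ∑ u, |A u w| * Hk z u) (b := fun w => ∑ u, |A u w| * K3 x y u) (h := fun w => ∑ u, |A u w| * Hk t u)
    (fun _ _ _ => rfl) (fun x z => whitenedV_hasDerivAt hUd A ψ x z) (fun x z s t => whitenedV_floor hU'd hHk A hlamA ψ x z s t) hcpos
    (fun x z s t => whitenedV_ceiling hU'd hHk A hlamA ψ x z s t)
    (fun x w hw z s t => by rw [if_neg hw]; exact whitenedV_cross hU'd hHk A ψ x w hw z s t)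
    (whitenedV_continuous hUd A ψ) hV0 hV2 hJ (fun x => by simp) hrow' hγ0 hγ1 hD hDC
    (fun w z' s₁ s₂ => whitened_obs_lipVec hU'd hHk A ψ z w z' s₁ s₂)
    (fun w z' s₁ s₂ => hessian_obs_lipVec hU''d hK3 A ψ x y w z' s₁ s₂)
    (fun w z' s₁ s₂ => whitened_obs_lipVec hU'd hHk A ψ t w z' s₁ s₂) _ _ (hI4 z _) (hIG4 _) (hI4 t _) (h4 z) hG4 (h4 t)


end Summit.QuantumFields.BalabanUV.T4Continuum.NE7b.SupWhitenedMixedThirdCumulantRaw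

end
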